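import Summits.ResolutionOfSingularities.ResolutionOfSingularities.Theorems.WildConesCampaignW46SurfacesMuDropShear

/-!
# [OURS · L1 W4.6, rung (i) — helper 2/3 of `…CampaignW46SurfacesMuDrop`] The shear automorphism, the chart
# intertwiner, and Huneke–Swanson's weak-transform inequality WITHOUT the transversality hypothesis

Cell res-hironaka (LADDER-RESOLUTION rung L, D-0089), slot W4.6, seat res-L1-s46-pv-2. Host: route `WildCones`,
crux `ClassicalRegimes` (stmt-ResolutionOfSingularities-16884), `--supports … --as helper`. Everything here is OURS;
no statement of H. Hironaka's manuscript; no FACT-LIST premise (Huneke–Swanson 14.3.4 enters only through the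
tree's PROVED `Literature.AlgebraicGeometry.Resolution.PlaneChart.finrank_quotient_weakTransform_add_le`). AI
review is weaker than expert review.

* `exists_shearEquiv` / `exists_shearEquiv'` — the shear `X i ↦ X i ± μ X j`, `X j ↦ X j` as a `κ`-algebra
  automorphism of `R = κ⟦X₀,X₁⟧` (`algHom_ext_X`);
* `chart_eq_chartMap`, `chartMap_eq_substAlgHom`, `chartMap_C` — an abstract chart endomorphism
  (`X i ↦ X i`, `X j ↦ X i (X j + t)`) is route FrobeniusClosing's `chartMap 2 κ i (fun _ => t)`;
* `exists_shear_intertwiner` — for `1 + μ t ≠ 0`: automorphisms `α` (the shear) and `ρ` with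
  `σ_{i, t/(1+μt)} ∘ α = ρ ∘ σ_{i,t}` and `ρ (X i) = X i · unit` (route FrobeniusClosing's
  `FactorizationProof.exists_intertwiner`, twice, and `eq_id_of_apply_chartMap`: the universal property of the
  point blow-up in formal coordinates, specialised to a linear change keeping the chart);
* `finrank_quotient_weakTransform_add_le_intrinsic` — **`dim_κ R/J′ + dim_κ R/𝔪ʳ ≤ dim_κ R/J`** for EVERY
  finite-colength `J ≤ 𝔪ʳ` (`r ≥ 1`, `κ` infinite) containing an element with a non-zero degree-`r` coefficient,
  and `J′` its weak transform at the point `t` of the `X i`-chart — the tree's lemma needs an element of `J`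
  whose initial form is prime to `X i`; a generic shear produces one for `α(J)`, the intertwiner identifies the
  weak transform of `α(J)` with `ρ(J′)`, and colengths are invariant under `α`, `ρ`.
-/

noncomputable section

-- single-problem summit: the doubled namespace component `ResolutionOfSingularities` is forced
set_option linter.dupNamespace false

open scoped BigOperators Classical
open MvPowerSeries IsLocalRing Finsupp Module
open Literature.RingTheory.MvPowerSeries.Jets Literature.RingTheory.Length
open Literature.AlgebraicGeometry.Resolution.PlaneChart

namespace Summit.ResolutionOfSingularities.ResolutionOfSingularities.Theorems

namespace CampaignW46.SurfacesMuDrop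

open WildCones

variable {κ : Type} [Field κ]

/-! ## 2. The shear `X i ↦ X i + μ X j` and the chart intertwiner -/

/-- The shear `X i ↦ X i + μ X j`, `X j ↦ X j` as a `κ`-algebra endomorphism of `κ⟦X₀,X₁⟧`
(a substitution with zero constant coefficients). [folklore] -/
theorem exists_shearAlgHom {i j : Fin 2} (hij : j ≠ i) (μ : κ) :
    ∃ α : MvPowerSeries (Fin 2) κ →ₐ[κ] MvPowerSeries (Fin 2) κ,
      α (X i) = X i + C μ * X j ∧ α (X j) = X j := by
  let a : Fin 2 → MvPowerSeries (Fin 2) κ := fun s => if s = i then X i + C μ * X j else X s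
  have ha0 : ∀ s, constantCoeff (a s) = 0 := by
    intro s
    by_cases hs : s = i
    · simp [a, hs, constantCoeff_X]
    · simp [a, hs, constantCoeff_X]
  have ha : HasSubst a := hasSubst_of_constantCoeff_zero ha0
  refine ⟨substAlgHom ha, ?_, ?_⟩
  · rw [substAlgHom_X]; simp [a]
  · rw [substAlgHom_X]; simp [a, hij]

/-- The shear as an AUTOMORPHISM, with its inverse `X i ↦ X i - μ X j`. [folklore] -/
theorem exists_shearEquiv {i j : Fin 2} (hij : j ≠ i) (μ : κ) :
    ∃ α : MvPowerSeries (Fin 2) κ ≃ₐ[κ] MvPowerSeries (Fin 2) κ,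
      α (X i) = X i + C μ * X j ∧ α (X j) = X j ∧
      α.symm (X i) = X i - C μ * X j ∧ α.symm (X j) = X j := by
  obtain ⟨α₁, h1i, h1j⟩ := exists_shearAlgHom hij μ
  obtain ⟨α₂, h2i, h2j⟩ := exists_shearAlgHom hij (-μ)
  have c12 : α₁.comp α₂ = AlgHom.id κ _ := by
    apply algHom_ext_X
    intro s
    rcases OrdPExitSurface.eq_or_eq i j hij s with rfl | rfl
    · rw [AlgHom.comp_apply, h2i, map_add, map_mul, algHom_C, h1i, h1j, AlgHom.id_apply, map_neg]
      ring
    · rw [AlgHom.comp_apply, h2j, h1j, AlgHom.id_apply]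
  have c21 : α₂.comp α₁ = AlgHom.id κ _ := by
    apply algHom_ext_X
    intro s
    rcases OrdPExitSurface.eq_or_eq i j hij s with rfl | rfl
    · rw [AlgHom.comp_apply, h1i, map_add, map_mul, algHom_C, h2i, h2j, AlgHom.id_apply, map_neg]
      ring
    · rw [AlgHom.comp_apply, h1j, h2j, AlgHom.id_apply]
  refine ⟨AlgEquiv.ofAlgHom α₁ α₂ c12 c21, h1i, h1j, ?_, ?_⟩
  · change α₂ (X i) = _
    rw [h2i, map_neg]; ring
  · change α₂ (X j) = _
    exact h2j

/-- The shear with the opposite sign: `α (X i) = X i - μ X j`, `α⁻¹ (X i) = X i + μ X j`. [folklore] -/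
theorem exists_shearEquiv' {i j : Fin 2} (hij : j ≠ i) (μ : κ) :
    ∃ α : MvPowerSeries (Fin 2) κ ≃ₐ[κ] MvPowerSeries (Fin 2) κ,
      α (X i) = X i - C μ * X j ∧ α (X j) = X j ∧
      α.symm (X i) = X i + C μ * X j ∧ α.symm (X j) = X j := by
  obtain ⟨α, h1, h2, h3, h4⟩ := exists_shearEquiv hij (-μ)
  refine ⟨α, ?_, h2, ?_, h4⟩
  · rw [h1, map_neg]; ring
  · rw [h3, map_neg]; ring

/-- Coefficients of the variables along `single s 1`. [folklore] -/
theorem coeff_single_one_X (s m : Fin 2) :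
    coeff (single m 1) (X s : MvPowerSeries (Fin 2) κ) = if m = s then 1 else 0 := by
  rw [coeff_X]
  by_cases h : m = s
  · rw [h, if_pos rfl, if_pos rfl]
  · rw [if_neg h, if_neg (fun h' => h ((single_left_inj one_ne_zero).mp h'))]

/-- An abstract chart endomorphism (`X i ↦ X i`, `X j ↦ X i (X j + t)`) IS route FrobeniusClosing's
`chartMap 2 κ i (fun _ => t)`. [folklore] -/
theorem chart_eq_chartMap {i j : Fin 2} (hij : j ≠ i) (t : κ)
    (Θ : MvPowerSeries (Fin 2) κ →ₐ[κ] MvPowerSeries (Fin 2) κ)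
    (hΘi : Θ (X i) = X i) (hΘj : Θ (X j) = X i * (X j + C t)) (f : MvPowerSeries (Fin 2) κ) :
    Θ f = FrobeniusClosing.chartMap 2 κ i (fun _ => t) f := by
  have h : Θ = substAlgHom (FrobeniusClosing.FactorizationProof.hasSubst_chartSubst (n := 2) (K := κ) i
      (fun _ => t)) := by
    apply algHom_ext_X
    intro s
    rw [substAlgHom_apply]
    rcases OrdPExitSurface.eq_or_eq i j hij s with rfl | rfl
    · rw [hΘi]
      exact (FrobeniusClosing.FactorizationProof.chartMap_X_self (n := 2) (K := κ) s (fun _ => t)).symm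
    · rw [hΘj]
      exact (FrobeniusClosing.FactorizationProof.chartMap_X_of_ne (n := 2) (K := κ) i (fun _ => t) hij).symm
  rw [h, substAlgHom_apply]
  rfl

/-- The chart map is the substitution algebra homomorphism of the chart family. [folklore] -/
theorem chartMap_eq_substAlgHom (i : Fin 2) (τ : Fin 2 → κ) (f : MvPowerSeries (Fin 2) κ) :
    FrobeniusClosing.chartMap 2 κ i τ f =
      substAlgHom (FrobeniusClosing.FactorizationProof.hasSubst_chartSubst (n := 2) (K := κ) i τ) f := by
  unfold FrobeniusClosing.chartMap
  rw [substAlgHom_apply]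

/-- The chart map fixes constants. [folklore] -/
theorem chartMap_C (i : Fin 2) (τ : Fin 2 → κ) (c : κ) :
    FrobeniusClosing.chartMap 2 κ i τ (C c) = C c := by
  rw [chartMap_eq_substAlgHom, algHom_C]

/-- **The chart intertwiner of a shear.** For `1 + μ t ≠ 0` there are the shear automorphism `α`
(`X i ↦ X i - μ X j`) and an AUTOMORPHISM `ρ` of `κ⟦X₀,X₁⟧` with
`σ_{i, t₁} ∘ α = ρ ∘ σ_{i, t}`, `t₁ = t / (1 + μ t)`, and `ρ (X i) = X i · (unit)`: the point `t` of the
exceptional line of the blow-up is, in the sheared coordinates, the point `t₁` of the same chart, and the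
two formal neighbourhoods are identified by `ρ` (route FrobeniusClosing's `exists_intertwiner`, twice,
and `eq_id_of_apply_chartMap`). [folklore] -/
theorem exists_shear_intertwiner {i j : Fin 2} (hij : j ≠ i) (t μ : κ) (hμ : 1 + μ * t ≠ 0) :
    ∃ (α ρ : MvPowerSeries (Fin 2) κ ≃ₐ[κ] MvPowerSeries (Fin 2) κ) (u : MvPowerSeries (Fin 2) κ),
      α (X i) = X i - C μ * X j ∧ α (X j) = X j ∧
      α.symm (X i) = X i + C μ * X j ∧ α.symm (X j) = X j ∧
      (∀ f, FrobeniusClosing.chartMap 2 κ i (fun _ => t / (1 + μ * t)) (α f) =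
        ρ (FrobeniusClosing.chartMap 2 κ i (fun _ => t) f)) ∧
      IsUnit u ∧ ρ (X i) = X i * u := by
  obtain ⟨α, hαi, hαj, hαsi, hαsj⟩ := exists_shearEquiv' hij μ
  set t₁ : κ := t / (1 + μ * t) with ht₁
  have ht₁' : t₁ * (1 + μ * t) = t := by rw [ht₁, div_mul_cancel₀ _ hμ]
  have hc : 1 - μ * t₁ = (1 + μ * t)⁻¹ := by
    rw [ht₁]; field_simp; ring
  -- coefficient bookkeeping
  have cii : coeff (single i 1) (X i : MvPowerSeries (Fin 2) κ) = 1 := by rw [coeff_single_one_X, if_pos rfl]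
  have cjj : coeff (single j 1) (X j : MvPowerSeries (Fin 2) κ) = 1 := by rw [coeff_single_one_X, if_pos rfl]
  have cij : coeff (single i 1) (X j : MvPowerSeries (Fin 2) κ) = 0 := by rw [coeff_single_one_X, if_neg hij.symm]
  have cji : coeff (single j 1) (X i : MvPowerSeries (Fin 2) κ) = 0 := by rw [coeff_single_one_X, if_neg hij]
  -- linear-part conditions for the two intertwiners
  have H1 : ∀ s, ∑ m, coeff (single m 1) ((α : MvPowerSeries (Fin 2) κ →ₐ[κ] _) (X s)) *
      (if m = i then 1 else (fun _ : Fin 2 => t₁) m) =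
        (1 + μ * t)⁻¹ * (if s = i then 1 else (fun _ : Fin 2 => t) s) := by
    intro s
    rw [sum_univ_two_eq hij, if_pos rfl, if_neg hij, AlgEquiv.coe_toAlgHom]
    rcases OrdPExitSurface.eq_or_eq i j hij s with rfl | rfl
    · rw [if_pos rfl, hαi, map_sub, map_sub, MvPowerSeries.coeff_C_mul,
        MvPowerSeries.coeff_C_mul, cii, cij, cji, cjj, ← hc]
      ring
    · rw [if_neg hij, hαj, cij, cjj, zero_mul, zero_add, one_mul, ht₁, div_eq_inv_mul]
  have H2 : ∀ s, ∑ m, coeff (single m 1) ((α.symm : MvPowerSeries (Fin 2) κ →ₐ[κ] _) (X s)) *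
      (if m = i then 1 else (fun _ : Fin 2 => t) m) =
        (1 + μ * t) * (if s = i then 1 else (fun _ : Fin 2 => t₁) s) := by
    intro s
    rw [sum_univ_two_eq hij, if_pos rfl, if_neg hij, AlgEquiv.coe_toAlgHom]
    rcases OrdPExitSurface.eq_or_eq i j hij s with rfl | rfl
    · rw [if_pos rfl, hαsi, map_add, map_add, MvPowerSeries.coeff_C_mul,
        MvPowerSeries.coeff_C_mul, cii, cij, cji, cjj]
      ring
    · rw [if_neg hij, hαsj, cij, cjj, zero_mul, zero_add, one_mul]
      change t = (1 + μ * t) * t₁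
      rw [mul_comm (1 + μ * t) t₁, ht₁']
  obtain ⟨ρ, hρ⟩ := FrobeniusClosing.FactorizationProof.exists_intertwiner (n := 2) (K := κ)
    (α : MvPowerSeries (Fin 2) κ →ₐ[κ] _) i i (fun _ => t) (fun _ => t₁) _ (inv_ne_zero hμ) H1
  obtain ⟨ρ', hρ'⟩ := FrobeniusClosing.FactorizationProof.exists_intertwiner (n := 2) (K := κ)
    (α.symm : MvPowerSeries (Fin 2) κ →ₐ[κ] _) i i (fun _ => t₁) (fun _ => t) _ hμ H2
  have hρ1 : ∀ f, FrobeniusClosing.chartMap 2 κ i (fun _ => t₁) (α f) =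
      ρ (FrobeniusClosing.chartMap 2 κ i (fun _ => t) f) := fun f => hρ f
  have hρ2 : ∀ f, FrobeniusClosing.chartMap 2 κ i (fun _ => t) (α.symm f) =
      ρ' (FrobeniusClosing.chartMap 2 κ i (fun _ => t₁) f) := fun f => hρ' f
  have h1 : ρ.comp ρ' = AlgHom.id κ (MvPowerSeries (Fin 2) κ) :=
    FrobeniusClosing.FactorizationProof.eq_id_of_apply_chartMap _ i (fun _ => t₁) fun f => by
      rw [AlgHom.comp_apply, ← hρ2, ← hρ1, AlgEquiv.apply_symm_apply]
  have h2 : ρ'.comp ρ = AlgHom.id κ (MvPowerSeries (Fin 2) κ) :=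
    FrobeniusClosing.FactorizationProof.eq_id_of_apply_chartMap _ i (fun _ => t) fun f => by
      rw [AlgHom.comp_apply, ← hρ1, ← hρ2, AlgEquiv.symm_apply_apply]
  -- `ρ (X i) = X i · u`
  have hρXi : ρ (X i) = X i * (1 - C μ * (X j + C t₁)) := by
    have h := hρ1 (X i)
    rw [FrobeniusClosing.FactorizationProof.chartMap_X_self, hαi, chartMap_eq_substAlgHom, map_sub, map_mul,
      algHom_C, substAlgHom_X, substAlgHom_X, FrobeniusClosing.FactorizationProof.chartSubst_eq_X_mul,
      FrobeniusClosing.FactorizationProof.chartSubst_eq_X_mul, if_pos rfl, if_neg hij] at h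
    rw [← h]; ring
  have hu : IsUnit (1 - C μ * (X j + C t₁) : MvPowerSeries (Fin 2) κ) := by
    rw [MvPowerSeries.isUnit_iff_constantCoeff]
    simp only [map_sub, map_one, map_mul, map_add, constantCoeff_C, constantCoeff_X, zero_add]
    rw [hc, isUnit_iff_ne_zero]
    exact inv_ne_zero hμ
  exact ⟨α, AlgEquiv.ofAlgHom ρ ρ' h1 h2, _, hαi, hαj, hαsi, hαsj, hρ1, hu, hρXi⟩

/-! ## 3. Huneke–Swanson's inequality for the weak transform WITHOUT the transversality hypothesis -/

/-- **`dim_κ R/J' + dim_κ R/𝔪ʳ ≤ dim_κ R/J`, intrinsically.** Let `J ≤ 𝔪ʳ` (`r ≥ 1`) be an ideal of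
`R = κ⟦X₀,X₁⟧` of finite colength containing an element `f` with a non-zero coefficient in degree `r`
(no position required of it), and `J'` with `Θ(J) R = (X i)ʳ J'` the weak transform at the point `t` of the
`X i`-chart, of finite colength; `κ` infinite. Then `dim R/J' + dim R/𝔪ʳ ≤ dim R/J`. The tree's
`finrank_quotient_weakTransform_add_le` needs `f ∉ (X i) + 𝔪ʳ⁺¹` (no base point at the point at infinity
of the chart); here a generic shear `X i ↦ X i - μ X j` moves the coordinates so that this holds for the
sheared ideal `α(J)` (the transversality functional `Σ f_l (-μ)^{r-l} ≠ 0`), the chart intertwiner `ρ`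
identifies the weak transform of `α(J)` at `t/(1 + μt)` with `ρ(J')`, and colengths are invariant under the
automorphisms `α`, `ρ`. [cite: HunekeSwanson2006, Lemma 14.3.4] -/
theorem finrank_quotient_weakTransform_add_le_intrinsic [Infinite κ] {i j : Fin 2} (hij : j ≠ i) (t : κ)
    (Θ : MvPowerSeries (Fin 2) κ →ₐ[κ] MvPowerSeries (Fin 2) κ)
    (hΘi : Θ (X i) = X i) (hΘj : Θ (X j) = X i * (X j + C t))
    {r : ℕ} (hr : 1 ≤ r)
    {J : Ideal (MvPowerSeries (Fin 2) κ)} (hJ : J ≤ maximalIdeal (MvPowerSeries (Fin 2) κ) ^ r)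
    {f : MvPowerSeries (Fin 2) κ} (hfJ : f ∈ J)
    (hf : ∃ l, l ≤ r ∧ coeff (single i (r - l) + single j l) f ≠ 0)
    [Module.Finite κ (MvPowerSeries (Fin 2) κ ⧸ J)]
    {J' : Ideal (MvPowerSeries (Fin 2) κ)}
    (hJ' : J.map (Θ : MvPowerSeries (Fin 2) κ →+* MvPowerSeries (Fin 2) κ) =
      Ideal.span {(X i : MvPowerSeries (Fin 2) κ) ^ r} * J')
    [Module.Finite κ (MvPowerSeries (Fin 2) κ ⧸ J')] :
    finrank κ (MvPowerSeries (Fin 2) κ ⧸ J') +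
        finrank κ (MvPowerSeries (Fin 2) κ ⧸ maximalIdeal (MvPowerSeries (Fin 2) κ) ^ r) ≤
      finrank κ (MvPowerSeries (Fin 2) κ ⧸ J) := by
  classical
  -- 1. a generic scalar
  obtain ⟨μ, hμF, hμt⟩ :=
    exists_generic_scalar (fun l => coeff (single i (r - l) + single j l) f) r hf t
  -- 2. shear and intertwiner
  obtain ⟨α, ρ, u, hαi, -, hαsi, -, hρ, hu, hρXi⟩ := exists_shear_intertwiner hij t μ hμt
  set t₁ : κ := t / (1 + μ * t) with ht₁
  let Θ₁ : MvPowerSeries (Fin 2) κ →ₐ[κ] MvPowerSeries (Fin 2) κ :=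
    substAlgHom (FrobeniusClosing.FactorizationProof.hasSubst_chartSubst (n := 2) (K := κ) i (fun _ => t₁))
  have hΘ₁ : ∀ g, Θ₁ g = FrobeniusClosing.chartMap 2 κ i (fun _ => t₁) g := fun g =>
    (chartMap_eq_substAlgHom i _ g).symm
  have hΘ₁i : Θ₁ (X i) = X i := by
    rw [hΘ₁]; exact FrobeniusClosing.FactorizationProof.chartMap_X_self (n := 2) (K := κ) i _
  have hΘ₁j : Θ₁ (X j) = X i * (X j + C t₁) := by
    rw [hΘ₁]; exact FrobeniusClosing.FactorizationProof.chartMap_X_of_ne (n := 2) (K := κ) i _ hij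
  have hΘ : ∀ g, Θ g = FrobeniusClosing.chartMap 2 κ i (fun _ => t) g := chart_eq_chartMap hij t Θ hΘi hΘj
  have hcomp : (Θ₁ : MvPowerSeries (Fin 2) κ →+* MvPowerSeries (Fin 2) κ).comp
      (α : MvPowerSeries (Fin 2) κ →+* MvPowerSeries (Fin 2) κ) =
      (ρ : MvPowerSeries (Fin 2) κ →+* MvPowerSeries (Fin 2) κ).comp
        (Θ : MvPowerSeries (Fin 2) κ →+* MvPowerSeries (Fin 2) κ) := by
    refine RingHom.ext fun g => ?_
    change Θ₁ (α g) = ρ (Θ g)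
    rw [hΘ₁, hΘ, hρ]
  -- 3. the sheared ideal `J₁ = α(J)`
  set J₁ : Ideal (MvPowerSeries (Fin 2) κ) := J.map (α : MvPowerSeries (Fin 2) κ →+* MvPowerSeries (Fin 2) κ)
    with hJ₁def
  have hJ₁ : J₁ ≤ maximalIdeal (MvPowerSeries (Fin 2) κ) ^ r := by
    rw [hJ₁def, Ideal.map_le_iff_le_comap]
    intro g hg
    exact algHom_apply_mem_maximalIdeal_pow (α : MvPowerSeries (Fin 2) κ →ₐ[κ] MvPowerSeries (Fin 2) κ) (hJ hg)
  have eJ : (MvPowerSeries (Fin 2) κ ⧸ J) ≃ₐ[κ] (MvPowerSeries (Fin 2) κ ⧸ J₁) :=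
    Ideal.quotientEquivAlg J J₁ α rfl
  haveI : Module.Finite κ (MvPowerSeries (Fin 2) κ ⧸ J₁) := Module.Finite.equiv eJ.toLinearEquiv
  have hfinrankJ : finrank κ (MvPowerSeries (Fin 2) κ ⧸ J₁) = finrank κ (MvPowerSeries (Fin 2) κ ⧸ J) :=
    (LinearEquiv.finrank_eq eJ.toLinearEquiv).symm
  -- the sheared `f` is transversal
  have hf₁J : α f ∈ J₁ := Ideal.mem_map_of_mem _ hfJ
  have hf₁ : α f ∉ Ideal.span {(X i : MvPowerSeries (Fin 2) κ)} ⊔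
      maximalIdeal (MvPowerSeries (Fin 2) κ) ^ (r + 1) := by
    intro hmem
    have hmem' : f ∈ Ideal.span {(X i + C μ * X j : MvPowerSeries (Fin 2) κ)} ⊔
        maximalIdeal (MvPowerSeries (Fin 2) κ) ^ (r + 1) := by
      rcases Submodule.mem_sup.mp hmem with ⟨a, ha, b, hb, hab⟩
      obtain ⟨q, rfl⟩ := Ideal.mem_span_singleton'.mp ha
      have hf' : f = α.symm (q * X i) + α.symm b := by
        rw [← map_add, hab, AlgEquiv.symm_apply_apply]
      rw [hf', map_mul, hαsi]
      exact Submodule.add_mem_sup (Ideal.mul_mem_left _ _ (Ideal.mem_span_singleton_self _))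
        (algHom_apply_mem_maximalIdeal_pow (α.symm : MvPowerSeries (Fin 2) κ →ₐ[κ] MvPowerSeries (Fin 2) κ) hb)
    rcases Submodule.mem_sup.mp hmem' with ⟨a, ha, b, hb, hab⟩
    obtain ⟨w, rfl⟩ := Ideal.mem_span_singleton'.mp ha
    have key := sum_coeff_shear_eq_zero hij μ r w b hb
    rw [mul_comm (X i + C μ * X j) w, hab] at key
    exact hμF key
  -- 4. the transformed ideal `J₁' = ρ(J')` and `Θ₁(J₁) R = (X i)^r J₁'`
  set J₁' : Ideal (MvPowerSeries (Fin 2) κ) :=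
    J'.map (ρ : MvPowerSeries (Fin 2) κ →+* MvPowerSeries (Fin 2) κ) with hJ₁'def
  have eJ' : (MvPowerSeries (Fin 2) κ ⧸ J') ≃ₐ[κ] (MvPowerSeries (Fin 2) κ ⧸ J₁') :=
    Ideal.quotientEquivAlg J' J₁' ρ rfl
  haveI : Module.Finite κ (MvPowerSeries (Fin 2) κ ⧸ J₁') := Module.Finite.equiv eJ'.toLinearEquiv
  have hfinrankJ' : finrank κ (MvPowerSeries (Fin 2) κ ⧸ J₁') = finrank κ (MvPowerSeries (Fin 2) κ ⧸ J') :=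
    (LinearEquiv.finrank_eq eJ'.toLinearEquiv).symm
  have hJ₁' : J₁.map (Θ₁ : MvPowerSeries (Fin 2) κ →+* MvPowerSeries (Fin 2) κ) =
      Ideal.span {(X i : MvPowerSeries (Fin 2) κ) ^ r} * J₁' := by
    rw [hJ₁def, Ideal.map_map, hcomp, ← Ideal.map_map, hJ', Ideal.map_mul, Ideal.map_span, Set.image_singleton,
      map_pow]
    change Ideal.span {(ρ (X i)) ^ r} * J₁' = _
    rw [hρXi, mul_pow, Ideal.span_singleton_mul_right_unit (hu.pow r)]
  -- 5. the chart algebra of `Θ₁` and Huneke–Swanson there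
  obtain ⟨B, hB⟩ := exists_chartSubalgebra Θ₁ hΘ₁i
  have hΘB : ∀ b, Θ₁ b ∈ B := fun b => (hB _).mpr ⟨0, b, by simp, by simp⟩
  letI : Algebra (MvPowerSeries (Fin 2) κ) B :=
    ((Θ₁ : MvPowerSeries (Fin 2) κ →+* MvPowerSeries (Fin 2) κ).codRestrict B hΘB).toAlgebra
  have halg : ∀ b, ((algebraMap (MvPowerSeries (Fin 2) κ) B b : B) : MvPowerSeries (Fin 2) κ) = Θ₁ b :=
    fun b => rfl
  have hBsurj : ∀ J₂ : Ideal (MvPowerSeries (Fin 2) κ), Module.Finite κ (MvPowerSeries (Fin 2) κ ⧸ J₂) →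
      Function.Surjective fun b : B => Ideal.Quotient.mk J₂ (b : MvPowerSeries (Fin 2) κ) := by
    intro J₂ hfin
    refine mk_comp_subtype_surjective_of_finite_quotient J₂ B fun l => ?_
    rcases OrdPExitSurface.eq_or_eq i j hij l with rfl | rfl
    · exact X_self_mem_chart Θ₁ hΘ₁i B hB
    · exact X_other_mem_chart t₁ Θ₁ hΘ₁i hΘ₁j B hB
  have hle := finrank_quotient_weakTransform_add_le hij t₁ Θ₁ hΘ₁i hΘ₁j B hB halg hBsurj hr hJ₁ hf₁J hf₁ hJ₁'
  have hfin : finrank κ (MvPowerSeries (Fin 2) κ ⧸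
      (J₁.map (algebraMap (MvPowerSeries (Fin 2) κ) B)).comap (algebraMap (MvPowerSeries (Fin 2) κ) B)) ≤
        finrank κ (MvPowerSeries (Fin 2) κ ⧸ J₁) :=
    finrank_quotient_le_of_le (κ := κ) Ideal.le_comap_map
  rw [hfinrankJ'] at hle
  rw [hfinrankJ] at hfin
  omega

end CampaignW46.SurfacesMuDrop

end Summit.ResolutionOfSingularities.ResolutionOfSingularities.Theorems

end
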